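import Summits.BirchSwinnertonDyer.Rank1Residual.Supersingular.KobayashiMainConjectureX6BSTWScopeS
import HarnessLib

/-!
# The `p = 3` CELL-CHAIN tier: the Eisenstein (lower) divisibility of Kobayashi's main conjecture at `p = 3` on
# BSTW's scope S, as a NAMED PROVENANCE BINDER for the in-cell, in-cell-refereed Ohta-free chain (cell `bsd-ssimc`;
# DRAFT by planner g32 for the k3 seat's object «P3CHAIN-TYPE-1», `HOME/bsd-ssimc-plan/P3CHAIN-INVENTORY-g32.md`
# 2852265edaedf112 §3.1; names AGREED with `bsd-print-x6` plan 2026-08-27T17:15:10Z, Q1 = cite-only on their side)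

HONEST FRAMING (cell README §4): nothing here is a theorem about any curve. `BSTW2024_lowerDivisibility_atThreeS_CELL`
is a `Prop` taken as an explicit HYPOTHESIS exactly like `BurungaleSkinnerTianWan2024_thm13_scopedAtThreeS_OPEN`, and it
is WEAKER than that binder (`lowerDivisibility_atThreeS_CELL_of_thm13_scopedAtThreeS_OPEN`). Its only purpose is
PROVENANCE BY NAME: the two sibling routes that close their `p = 3` segment modulo the preprint-on-preprint tier
(`route-BirchSwinnertonDyer-SignedLowerHalves` crux `KobayashiLowerHalfSemistable`, stmt-BirchSwinnertonDyer-19000, via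
`…Theorems.KobayashiLowerHalfSemistable_of_tiersS_S3`; `route-BirchSwinnertonDyer-PrintX6` crux `EisensteinHalfAtThree`,
stmt-BirchSwinnertonDyer-20285, via `Theorems/PrintX6BSTWByName.lean`) can instead cite THIS decl, whose docstring names
the cell-side chain that certifies the Eisenstein half at `3` WITHOUT [SV-S-Ohta], memo by memo with sha16 and referee
report. The register word at `p = 3` (keep «GAP(line)@3» or re-grade to an in-cell grade) is the literature register's
(`bsd-litref`, request L31-9 of 2026-08-27T15:30:07Z), not this file's; director-bsd TIER RULING (3) 2026-08-27T15:28:28Z.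

WHY THE CONCLUSION IS THE LOWER DIVISIBILITY ONLY: (a) it is what both consumers need (`KobayashiLowerHalfSemistable`
concludes `∃ ε, KobayashiLowerDivisibility W p ε`; `EisensteinHalfAtThree` is the Eisenstein half); (b) it is what the
chain is load-bearing for (the Beilinson–Flach side of BSTW's proof; the opposite divisibility is Kato + Kobayashi / Kim
control, in refereed print at every `p` on class X6); (c) a verbatim-body twin of the `_OPEN` binder would be a duplicate
declaration.

THE CHAIN (cell HOME = `run/shared/lean/pub/bsd-ssimc/`; every link PROSE at statement level, refereed in-cell; the
kernel holds only the commutative-algebra skeletons named below):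
* A — bstw-MEMO-11 cb85d30b99168706 Thm A: BSTW I (Ind) = Thm 4.19 bullets 1–2 at `p = 3` without Ohta ((F3)
  trichotomy + Lemma K + exponent one; the located bit (3-ii)♭′ killed by the cuspidal renormalisation ℒ′ = 𝓛_p^Gr/T_v);
  kernel skeletons `…Theorems.SignLattices.eq_of_swap_stable_of_saturated` / `eq_of_plus_le` (p471034),
  `…Theorems.SignLatticesB.eq_of_signed_le` (p484810), `…Theorems.IndexTransfer.*` (p456967), `…Theorems.SplitBit.*`
  (p466898 / p467108); referee REPORT-bstw-11 49cae1424c3af3a3 PASS; red-team bstw-MEMO-25 74dbd8e811fbcf39 (P2) HOLDS.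
* B — MEMO-11 Thm B: the Beilinson–Flach class is integral in H¹_{rel,ord/∘} (= BSTW Thms 4.20 / 5.22) Ohta-free, by the
  (S3) descent (`…SignLattices.descent_step`); REPORT-bstw-11 PASS.
* C — MEMO-11 Thm C: the v̄-Coleman map is intrinsic on 𝕋₁, ℒ_p^Gr well defined, interpolation = Thm 4.11 ÷ (χ₁(γ_v) − 1);
  REPORT-bstw-11 PASS; MEMO-25 (P1) HOLDS.
* D1–D3 — bstw-MEMO-12 658adafc97caf8bd: (D1) the e′-ordinary cusps of Y₁(D_L p^r) are unramified at p with
  Frob_p^ss = (U′_p)^ss (any p ∤ D_L); (D2) = (O4a) at 3 (Kummer / 1-motive step from (D1)(iii), Cais II, Manin–Drinfeld;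
  kernel skeleton `…Theorems.KummerSkeleton.sub_mem_of_cais_of_maninDrinfeld'` with necessity witness
  `exists_witness_without_splitting`, p478692); (D3) (B1-b)/(B1-c) located in [KLZ17] Prop 7.2.1 at 3
  (`…KummerSkeleton.range_exact_of_idempotents`); REPORT-bstw-11 PASS, kernel leg REPORT-bstw-12 faa796984645f3e1 PASS.
* T — bstw-MEMO-14 9d12874119a7657d: G8 = BSTW I §4.4's auxiliary ordinary newform at (3, ω⁰), closed by transposition
  ([LZ16] 5.4.2 / 7.1.2 / 7.1.4 + [LZ16] 6.4.1 ⟸ [AIS15], p ≥ 3; [Hid91] + EMI analytic side), fallback (S) bstw-MEMO-15;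
  REPORT-bstw-13 54077fe196a1add9 PASS, REPORT-bstw-14 fb99cd4b44958063 PASS; concordant with litref yz26-r1 514092271c8b576c.
* M1–M3 — bstw-MEMO-7 1fa682b12be3a3f9: refereed-print replacements at 3 (Cais I/II; EMI = [KLZ17] Prop 7.2.1;
  [Hid91]); REPORT-bstw-7 40fdbe7e627732c4 PASS.
* F1 — MEMO-25: BSTW I Prop 4.22 p-uniform, HOLDS-WITH-PATCH (citation-free); REPORT-bstw-24 (LOW) pending at draft time.
Print inputs at 3 used by the chain (refereed): Cais 2018 I/II; Kings–Loeffler–Zerbes 2017 Prop 7.2.1, Lemma 8.1.5,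
Prop 8.1.7; Manin–Drinfeld; Loeffler–Zerbes 2016; Andreatta–Iovita–Stevens 2015; Hida 1991; Diamond–Shurman GTM 228.
NOT claimed anywhere: that any of A … T is a kernel theorem; that BSD or Kobayashi's conjecture holds for any curve.
-/

set_option autoImplicit false

noncomputable section

open scoped Classical MatrixGroups ModularForm

open CongruenceSubgroup WeierstrassCurve NumberField Literature.NumberTheory.EllipticCurves
  Literature.NumberTheory.EllipticCurves.ModularForms
  Literature.NumberTheory.EllipticCurves.Rank1Residual
  Literature.NumberTheory.EllipticCurves.Rank1Residual.Typed

namespace Summit.BirchSwinnertonDyer.Rank1Residual.Supersingular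

/-- **CELL-CHAIN BINDER — the `p = 3` S-scoped tier, EISENSTEIN HALF ONLY.** For `p = 3`, `W` semistable, good
supersingular at `3` with `a₃ = 0`, and a class-number-free scope witness (`BSTWScope.HasAuxWitness W p`, always
available), the Eisenstein (lower) divisibility `KobayashiLowerDivisibility W p ε` for every sign `ε`. PROVENANCE: the
in-cell Ohta-free chain of cell `bsd-ssimc` (module docstring: MEMO-11 cb85d30b99168706 Thms A/B/C, MEMO-12
658adafc97caf8bd (D1)–(D3), MEMO-14 9d12874119a7657d (T), MEMO-7 1fa682b12be3a3f9 M1–M3; referee REPORT-bstw-7, -10, -11, -12, -13, -14 PASS; red-team MEMO-25 74dbd8e811fbcf39) in place of BSTW's [SV-S-Ohta] segment. Register word at `3`: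
litref L31-9 (pending at filing). Provenance tag in PROSE (agreed with `bsd-print-x6` plan 2026-08-27T17:15:10Z; not a bracket claim, whose
key must be a references.bib key): «claim: bsd-ssimc cell chain MEMO-11/12/14 — status: in-cell-refereed». WEAKER than
`BurungaleSkinnerTianWan2024_thm13_scopedAtThreeS_OPEN`
(`lowerDivisibility_atThreeS_CELL_of_thm13_scopedAtThreeS_OPEN`). NEVER cite this `Prop` as a theorem; take it as an
explicit hypothesis. Nothing asserted.
[claim: BurungaleSkinnerTianWan2024, status: under-review]
[cite: Kobayashi2003, Conjecture (Main Conjecture) (p. 2) (shape of the conclusion only; nothing asserted)] -/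
def BSTW2024_lowerDivisibility_atThreeS_CELL : Prop :=
  ∀ (W : WeierstrassCurve ℚ) [W.IsElliptic] [W.IsGloballyMinimal] (p : ℕ) [Fact p.Prime],
    p = 3 → Semistable W → GoodSS W p → W.frobeniusTrace 3 = 0 → BSTWScope.HasAuxWitness W p →
      ∀ ε : ℤˣ, KobayashiLowerDivisibility W p ε

/-- Taking the CELL-chain binder is NEVER stronger than taking the `p = 3` S-scoped preprint tier: the latter gives
the full main conjecture, which implies its Eisenstein half (`kobayashiLowerDivisibility_of_mainConjecture`).
[claim: BurungaleSkinnerTianWan2024, status: under-review] -/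
theorem lowerDivisibility_atThreeS_CELL_of_thm13_scopedAtThreeS_OPEN
    (h : BurungaleSkinnerTianWan2024_thm13_scopedAtThreeS_OPEN) :
    BSTW2024_lowerDivisibility_atThreeS_CELL :=
  fun W _ _ p _ h3 hsst hss ha3 hw ε => kobayashiLowerDivisibility_of_mainConjecture (h W p h3 hsst hss ha3 hw ε)

/-- Hence also from the printed binder (sanity composition; closes nothing).
[claim: BurungaleSkinnerTianWan2024, status: under-review] -/
theorem lowerDivisibility_atThreeS_CELL_of_thm13_OPEN (h : BurungaleSkinnerTianWan2024_thm13_OPEN) :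
    BSTW2024_lowerDivisibility_atThreeS_CELL :=
  lowerDivisibility_atThreeS_CELL_of_thm13_scopedAtThreeS_OPEN (thm13_scopedAtThreeS_OPEN_of_thm13_OPEN h)

section Consumers

variable (W : WeierstrassCurve ℚ) [W.IsElliptic] [W.IsGloballyMinimal] (p : ℕ) [Fact p.Prime]

/-- **The Eisenstein half on X6 at `p = 3`, every sign, MODULO the CELL-chain binder and a class-number-free
witness** (`ClassX6 W 3` supplies semistability, good supersingular reduction and `a₃ = 0`). Mirror of
`X6.kobayashiLowerDivisibility_of_thm13_scopedAtThreeS_OPEN_of_hasAuxWitness`. CONDITIONAL; closes nothing.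
[claim: BurungaleSkinnerTianWan2024, status: under-review] [cite: Kobayashi2003, Conjecture (Main Conjecture) (p. 2)] -/
theorem X6.kobayashiLowerDivisibility_of_lowerDivisibility_atThreeS_CELL_of_hasAuxWitness
    (h : BSTW2024_lowerDivisibility_atThreeS_CELL) (h3 : p = 3) (hX : ClassX6 W p)
    (hw : BSTWScope.HasAuxWitness W p) (ε : ℤˣ) : KobayashiLowerDivisibility W p ε := by
  have ha3 : W.frobeniusTrace 3 = 0 := by
    rcases hX.2.2 with h5 | h0
    · omega
    · exact h0
  exact h W p h3 hX.2.1 hX.1 ha3 hw ε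

end Consumers

end Summit.BirchSwinnertonDyer.Rank1Residual.Supersingular

end
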